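import Mathlib.Combinatorics.SetFamily.FourFunctions
import HarnessLib

/-!
# The four functions theorem along the antipodal map

Let `α` be a finite Boolean algebra (e.g. the cube `Finset ι` of subsets of a finite type) and let
`f₁ f₂ f₃ f₄ : α → β` be nonnegative functions satisfying the Ahlswede–Daykin hypothesis
`f₁ a * f₂ b ≤ f₃ (a ⊓ b) * f₄ (a ⊔ b)` for all `a, b`.  The **four functions theorem**
[cite: AhlswedeDaykin1978, Theorem 1] (Mathlib: `four_functions_theorem_univ`) concludes
`(∑ a, f₁ a) * (∑ b, f₂ b) ≤ (∑ c, f₃ c) * (∑ d, f₄ d)`, an inequality between sums over *all*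
pairs `(a, b)`.  This file records the refinement along **antipodal pairs** `(a, aᶜ)`:

* `four_functions_antipodal` : `∑ a, f₁ a * f₂ aᶜ ≤ ∑ a, f₃ a * f₄ aᶜ`.

Equivalently: the conclusion of the four functions theorem on a cube already holds *fibrewise* over
the map `(a, b) ↦ (a ⊓ b, a ⊔ b)` — restricted to a fibre `{(a, b) : a ⊓ b = F, a ⊔ b = G}` (an
interval `[F, G]`, itself a Boolean algebra in which `b` is the relative complement of `a`) both
sides of the theorem become sums over antipodal pairs, and the lemma applies to the interval.
For up-sets `A, B` of the cube (take `f₁ = 𝟙_A`, `f₂ = 𝟙_B`, `f₃ = 1`, `f₄ = 𝟙_{A ∩ B}`) it gives the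
fibrewise Harris–Kleitman inequality `#{a : a ∈ A, aᶜ ∈ B} ≤ #{a : a ∈ A ∩ B}`.

Provenance (recorded 2026-08-20, after landing; attribution as reported in [ChanPak2026, §12.1], the
1987 note itself being paywalled, acquisition request acq-09161): this is REUTER's inequality
[cite: Reuter1987, Theorem] (K. Reuter, *Note on the Ahlswede–Daykin inequality*, Discrete Math. 65
(1987) 209–212) — the case
"`C = L`, `D = ∅`" of the RLS inequality in the words of [ChanPak2026, §12.1, Thm 12.1]: the fibrewise
four functions theorem over `(a, b) ↦ (a ⊓ b, a ⊔ b)` holds for every fibre of the Boolean lattice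
[LovaszSaks2006, Thm 8] and of every finite distributive lattice [ChanPak2023, Claim 6.3]; the general
fibrewise theorem is `Literature.Combinatorics.SetFamily.four_functions_fibre`
(`LocalizedFourFunctions.lean`), whose `(⊥, ⊤)` fibre is the present statement
(`sum_meetJoinFibre_bot_top`).

Proof (a two-line consequence of [cite: AhlswedeDaykin1978, Theorem 1], derived in this
file; it is the Boolean case of the printed proof of [ChanPak2023, Claim 6.3]): with `A a := f₁ a * f₂ aᶜ`
and `C c := f₃ c * f₄ cᶜ`, two applications of the hypothesis
give `A a * A bᶜ ≤ C (a ⊓ b) * C (a ⊔ b)ᶜ`, i.e. the Ahlswede–Daykin hypothesis for the four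
functions `(A, A ∘ ᶜ, C, C ∘ ᶜ)`; the four functions theorem applied to them yields
`(∑ A)² ≤ (∑ C)²` after reindexing two of the sums along the involution `ᶜ`.

## References

* R. Ahlswede, D. E. Daykin, *An inequality for the weights of two families of sets, their unions
  and intersections*, Z. Wahrsch. Verw. Gebiete 43 (1978) 183–185. [cite: AhlswedeDaykin1978]
* K. Reuter, *Note on the Ahlswede–Daykin inequality*, Discrete Math. 65 (1987) 209–212.
  [cite: Reuter1987]
* L. Lovász, M. Saks, *A localization inequality for set functions*, J. Combin. Theory Ser. A 113
  (2006) 726–735, Thm 8. [LovaszSaks2006]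
* S. H. Chan, I. Pak, *Multivariate correlation inequalities for P-partitions*, Pacific J. Math. 323
  (2023) 223–252, Claim 6.3; *Equality conditions for correlation inequalities*, arXiv:2607.06275,
  Thm 12.1. [ChanPak2023] [ChanPak2026]
-/

namespace Literature.Combinatorics.SetFamily

open Finset BigOperators

variable {α β : Type*} [BooleanAlgebra α] [Fintype α]
  [CommSemiring β] [LinearOrder β] [IsStrictOrderedRing β] [ExistsAddOfLE β]

/-- **Four functions theorem along antipodal pairs.**  If nonnegative `f₁ f₂ f₃ f₄` on a finite
Boolean algebra satisfy the Ahlswede–Daykin hypothesis `f₁ a * f₂ b ≤ f₃ (a ⊓ b) * f₄ (a ⊔ b)`, then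
`∑ a, f₁ a * f₂ aᶜ ≤ ∑ a, f₃ a * f₄ aᶜ`.
Reuter's inequality [cite: Reuter1987, Theorem] (attribution as reported in [ChanPak2026, §12.1]:
the case `C = L, D = ∅` of the RLS inequality, Thm 12.1 there; every fibre, every finite distributive
lattice: `four_functions_fibre`); derived in this file from [cite: AhlswedeDaykin1978, Theorem 1]. -/
theorem four_functions_antipodal (f₁ f₂ f₃ f₄ : α → β)
    (h₁ : 0 ≤ f₁) (h₂ : 0 ≤ f₂) (h₃ : 0 ≤ f₃) (h₄ : 0 ≤ f₄)
    (h : ∀ a b, f₁ a * f₂ b ≤ f₃ (a ⊓ b) * f₄ (a ⊔ b)) :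
    ∑ a, f₁ a * f₂ aᶜ ≤ ∑ a, f₃ a * f₄ aᶜ := by
  classical
  set A : α → β := fun a ↦ f₁ a * f₂ aᶜ with hA_def
  set C : α → β := fun c ↦ f₃ c * f₄ cᶜ with hC_def
  have hA : 0 ≤ A := fun a ↦ mul_nonneg (h₁ a) (h₂ aᶜ)
  have hC : 0 ≤ C := fun c ↦ mul_nonneg (h₃ c) (h₄ cᶜ)
  have hAc : 0 ≤ fun b ↦ A bᶜ := fun b ↦ hA bᶜ
  have hCc : 0 ≤ fun d ↦ C dᶜ := fun d ↦ hC dᶜ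
  -- the Ahlswede–Daykin hypothesis for `(A, A ∘ ᶜ, C, C ∘ ᶜ)`
  have hyp : ∀ a b, A a * (fun b ↦ A bᶜ) b ≤ C (a ⊓ b) * (fun d ↦ C dᶜ) (a ⊔ b) := by
    intro a b
    have e1 := h a b
    have e2 := h bᶜ aᶜ
    simp only [hA_def, hC_def, compl_compl, compl_sup, compl_inf]
    rw [← compl_sup, ← compl_inf] at e2
    have n1 : 0 ≤ f₁ a * f₂ b := mul_nonneg (h₁ a) (h₂ b)
    have n2 : 0 ≤ f₁ bᶜ * f₂ aᶜ := mul_nonneg (h₁ bᶜ) (h₂ aᶜ)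
    calc f₁ a * f₂ aᶜ * (f₁ bᶜ * f₂ b)
        = (f₁ a * f₂ b) * (f₁ bᶜ * f₂ aᶜ) := by ring
      _ ≤ (f₃ (a ⊓ b) * f₄ (a ⊔ b)) * (f₃ (b ⊔ a)ᶜ * f₄ (b ⊓ a)ᶜ) :=
          mul_le_mul e1 e2 n2 (mul_nonneg (h₃ _) (h₄ _))
      _ = f₃ (a ⊓ b) * f₄ (aᶜ ⊔ bᶜ) * (f₃ (aᶜ ⊓ bᶜ) * f₄ (a ⊔ b)) := by
          rw [sup_comm b a, inf_comm b a, compl_sup, compl_inf]; ring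
  have ad := four_functions_theorem_univ A (fun b ↦ A bᶜ) C (fun d ↦ C dᶜ) hA hAc hC hCc hyp
  -- reindex the sums along the involution `ᶜ`
  have sA : ∑ b, (fun b ↦ A bᶜ) b = ∑ a, A a :=
    Fintype.sum_equiv (Function.Involutive.toPerm compl compl_involutive) _ _ (fun _ ↦ rfl)
  have sC : ∑ d, (fun d ↦ C dᶜ) d = ∑ c, C c :=
    Fintype.sum_equiv (Function.Involutive.toPerm compl compl_involutive) _ _ (fun _ ↦ rfl)
  rw [sA, sC] at ad
  have h0A : 0 ≤ ∑ a, A a := Finset.sum_nonneg fun a _ ↦ hA a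
  have h0C : 0 ≤ ∑ c, C c := Finset.sum_nonneg fun c _ ↦ hC c
  -- `(∑ A)² ≤ (∑ C)²` with both sums nonnegative
  rcases le_or_gt (∑ a, A a) (∑ c, C c) with hle | hlt
  · exact hle
  · exact absurd ad (not_le.mpr (mul_self_lt_mul_self h0C hlt))

/-- Cardinality form (fibrewise Daykin/Kleitman): for families `𝒜 ℬ 𝒞 𝒟` of elements of a finite
Boolean algebra with `a ∈ 𝒜 → b ∈ ℬ → a ⊓ b ∈ 𝒞 ∧ a ⊔ b ∈ 𝒟`, the number of `a ∈ 𝒜` with `aᶜ ∈ ℬ`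
is at most the number of `c ∈ 𝒞` with `cᶜ ∈ 𝒟`.
The indicator case of Reuter's inequality [cite: Reuter1987, Theorem] (attribution as reported in
[ChanPak2026, §12.1]; derived in this file from [cite: AhlswedeDaykin1978, Theorem 1]; general fibres:
`card_meetJoinFibre_filter_le` in `LocalizedFourFunctions.lean`). -/
theorem card_antipodal_le [DecidableEq α] (𝒜 ℬ 𝒞 𝒟 : Finset α)
    (h : ∀ a ∈ 𝒜, ∀ b ∈ ℬ, a ⊓ b ∈ 𝒞 ∧ a ⊔ b ∈ 𝒟) :
    #{a ∈ 𝒜 | aᶜ ∈ ℬ} ≤ #{c ∈ 𝒞 | cᶜ ∈ 𝒟} := by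
  classical
  have key := four_functions_antipodal (β := ℕ)
    (fun a ↦ if a ∈ 𝒜 then 1 else 0) (fun b ↦ if b ∈ ℬ then 1 else 0)
    (fun c ↦ if c ∈ 𝒞 then 1 else 0) (fun d ↦ if d ∈ 𝒟 then 1 else 0)
    (fun _ ↦ by positivity) (fun _ ↦ by positivity) (fun _ ↦ by positivity)
    (fun _ ↦ by positivity) ?_
  · have e : ∀ S T : Finset α,
        (∑ x, (if x ∈ S then 1 else 0) * (if xᶜ ∈ T then 1 else 0) : ℕ) = #{a ∈ S | aᶜ ∈ T} := by
      intro S T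
      rw [Finset.card_filter, ← Finset.filter_univ_mem S, Finset.sum_filter, Finset.filter_univ_mem]
      refine Finset.sum_congr rfl fun x _ ↦ ?_
      split_ifs <;> simp_all
    simpa only [e] using key
  · intro a b
    by_cases ha : a ∈ 𝒜
    · by_cases hb : b ∈ ℬ
      · obtain ⟨hc, hd⟩ := h a ha b hb
        simp [ha, hb, hc, hd]
      · simp [hb]
    · simp [ha]

end Literature.Combinatorics.SetFamily
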